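import Mathlib
import HarnessLib
import Summits.HubbardSuperconductivity.HubbardSuperconductivity.Theorems.KLProgrammeKLRegimeWickCrossContractionSupport

/-!
# Route `KLProgramme` — ENGINE item stmt-HubbardSuperconductivity-20437, class #6 / (E5-F)ₙ producer, route (M) ((α-0) memo), M1: the MOMENTUM MASS of the
# near term — `Σ_k (∏_i ‖F_{Ω_i}(k_i)‖)·‖ker(k)‖ ≤ (∏_{i ≥ 1} Σ_q ‖F_{Ω_i}(q)‖)·sup_{supp} ‖ker‖` for a momentum- AND frequency-conserving polynomial (in
# particular `𝒱_n[K]`): conservation removes the pinned leg's momentum sum, so only the FREE legs' multiplier masses appear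

Cell gate-hubbard-kl, seat hubbard-kl-k3c2-p2 (g10; bidder for M1 + M3 of route (M)).  `…EngineFixedTupleNearFar.fixedTupleL1_sectorisedKernel_le_near_add_far` (p567419)
bounds the near part of the fixed-tuple size by `ε^m·N_R^m·(Σ_k (∏_i ‖F_{Ω_i}(k_i)‖)·‖kernel G (m+1) k‖)`.  Here that momentum mass is reduced to what route (M) wants: the
product of the FREE legs' multiplier masses `Σ_q ‖F_{Ω_i}(q)‖` (= support counts, `‖F‖ ≤ 1`) times the sup of the momentum kernel on the tuple's support — because for a
polynomial whose kernels conserve frequency (`kernel_klEffectiveAction_eq_zero_of_freq`) and momentum (`klEffectiveAction_momentumConserving`) the pinned leg's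
frequency–momentum is DETERMINED by the free legs' (at most one nonzero term in the `k₀`-sum):

* `card_filter_kernel_cons_ne_zero_le_one` — for conserving `G`, fixed free momenta `k′` and labels: `#{k₀ : kernel G (m+1) ((k₀, k′)-tuple) ≠ 0} ≤ 1`;
* **`sum_prod_norm_mul_norm_kernel_le_of_conserving`** — `Σ_k (∏_i ‖F_{Ω_i}(k_i)‖)·‖ker(k)‖ ≤ (∏_{i : Fin m} Σ_q ‖F_{Ω_{i+1}}(q)‖)·B` whenever `‖F‖ ≤ 1` and `‖ker(k)‖ ≤ B` on the
  tuples with every `F_{Ω_i}(k_i) ≠ 0`;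
* **`sum_prod_norm_mul_norm_kernel_klEffectiveAction_le`** — the instance `G = klEffectiveAction L M β U μ K e₀ n` (both conservation laws are in the tree).

Everything is proved; no definitions; nothing about the model is asserted beyond these implications.
[cite: BenfattoGiulianiMastropietro2006, §2.7 (2.70)–(2.71)]
-/

noncomputable section

namespace Summit.HubbardSuperconductivity.HubbardSuperconductivity.Theorems.EngineV8

set_option linter.dupNamespace false -- summit = problem name (single-conjunct summit), D-0017

open Classical
open Real Finset Literature.MathematicalPhysics.QuantumLattice Literature.Probability.LatticeModels GrassmannAlgebra
open Summit.HubbardSuperconductivity.HubbardSuperconductivity.Theorems.KLProgrammeLegKernels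
open Summit.HubbardSuperconductivity.HubbardSuperconductivity.Theorems.KLRegimeSplit
open Summit.HubbardSuperconductivity.HubbardSuperconductivity.Theorems.KLRegimeWick

variable {L M : ℕ} [NeZero L]

omit [NeZero L] in
/-- `matsubaraInt` is injective (it is `i ↦ i − M`). -/
private theorem matsubaraInt_inj {M : ℕ} {i j : MatsubaraIdx M} (h : matsubaraInt M i = matsubaraInt M j) : i = j := by
  unfold matsubaraInt at h
  apply Fin.ext
  have : ((i : ℕ) : ℤ) = ((j : ℕ) : ℤ) := by linarith
  exact_mod_cast this

omit [NeZero L] in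
/-- `signedMomentum c` is injective in the momentum (it is `k ↦ ±k`). -/
private theorem signedMomentum_inj (c : Fin 2) {k k' : TorusSite 2 L} (h : signedMomentum L c k = signedMomentum L c k') : k = k' := by
  unfold signedMomentum at h
  split_ifs at h with hc
  · exact h
  · exact neg_injective h

/-- **At most one pinned momentum**: for a frequency- and momentum-conserving polynomial `G`, free-leg momenta `k′ : Fin m → FreqMomentum` and labels `Ω`, the set of
`k₀` for which `kernel G (m+1)` of the tuple `(k₀ :: k′)` (with `Ω`'s spins and charges) is nonzero has at most one element. -/
theorem card_filter_kernel_cons_ne_zero_le_one {N : ℕ} (G : HubbardGrassmann L M)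
    (hfreq : ∀ (m : ℕ) (X : Fin m → HubbardFieldIdx L M),
      (∑ i, (if (X i).2 = 0 then (1 : ℤ) else -1) * matsubaraInt M (X i).1.1.1) ≠ 0 → kernel ℂ G m X = 0)
    (hmom : ∀ (m : ℕ) (X : Fin m → HubbardFieldIdx L M), (∑ i, signedMomentum L (X i).2 (X i).1.1.2) ≠ 0 → kernel ℂ G m X = 0)
    (m : ℕ) (Ω : Fin (m + 1) → SectorLeg N) (k' : Fin m → FreqMomentum L M) :
    ((univ : Finset (FreqMomentum L M)).filter fun k₀ =>
      kernel ℂ G (m + 1) (fun i => ((Matrix.vecCons k₀ k' i, (Ω i).1.2), (Ω i).2)) ≠ 0).card ≤ 1 := by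
  refine Finset.card_le_one.2 fun a ha b hb => ?_
  have ha' := (mem_filter.1 ha).2
  have hb' := (mem_filter.1 hb).2
  -- the two conservation identities for `a` and for `b`
  have hfa : (∑ i : Fin (m + 1), (if (Ω i).2 = 0 then (1 : ℤ) else -1) * matsubaraInt M (Matrix.vecCons a k' i).1) = 0 := by
    by_contra h; exact ha' (hfreq (m + 1) _ (by simpa using h))
  have hfb : (∑ i : Fin (m + 1), (if (Ω i).2 = 0 then (1 : ℤ) else -1) * matsubaraInt M (Matrix.vecCons b k' i).1) = 0 := by
    by_contra h; exact hb' (hfreq (m + 1) _ (by simpa using h))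
  have hma : (∑ i : Fin (m + 1), signedMomentum L (Ω i).2 (Matrix.vecCons a k' i).2) = 0 := by
    by_contra h; exact ha' (hmom (m + 1) _ (by simpa using h))
  have hmb : (∑ i : Fin (m + 1), signedMomentum L (Ω i).2 (Matrix.vecCons b k' i).2) = 0 := by
    by_contra h; exact hb' (hmom (m + 1) _ (by simpa using h))
  rw [Fin.sum_univ_succ] at hfa hfb hma hmb
  simp only [Matrix.cons_val_zero, Matrix.cons_val_succ] at hfa hfb hma hmb
  -- frequency of the pinned leg
  have h1 : (if (Ω 0).2 = 0 then (1 : ℤ) else -1) * matsubaraInt M a.1 = (if (Ω 0).2 = 0 then (1 : ℤ) else -1) * matsubaraInt M b.1 := by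
    linarith
  have hs : (if (Ω 0).2 = 0 then (1 : ℤ) else -1) ≠ 0 := by split_ifs <;> norm_num
  have hfreq' : a.1 = b.1 := matsubaraInt_inj (mul_left_cancel₀ hs h1)
  -- momentum of the pinned leg
  have h2 : signedMomentum L (Ω 0).2 a.2 = signedMomentum L (Ω 0).2 b.2 := by
    have e1 : signedMomentum L (Ω 0).2 a.2 = -∑ i : Fin m, signedMomentum L (Ω i.succ).2 (k' i).2 := eq_neg_of_add_eq_zero_left hma
    have e2 : signedMomentum L (Ω 0).2 b.2 = -∑ i : Fin m, signedMomentum L (Ω i.succ).2 (k' i).2 := eq_neg_of_add_eq_zero_left hmb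
    rw [e1, e2]
  exact Prod.ext hfreq' (signedMomentum_inj (Ω 0).2 h2)

/-- **The momentum mass of the near term for a conserving polynomial**: if `‖F_ω‖ ≤ 1`, the kernels of `G` conserve frequency and momentum, and
`‖kernel G (m+1) k‖ ≤ B` on every tuple `k` lying in the supports of the `F_{Ω_i}`, then
`Σ_k (∏_i ‖F_{Ω_i}(k_i)‖)·‖kernel G (m+1) k‖ ≤ (∏_{i : Fin m} Σ_q ‖F_{Ω_{i+1}}(q)‖)·B` — only the FREE legs' multiplier masses appear. [cite: BenfattoGiulianiMastropietro2006, §2.7 (2.71)] -/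
theorem sum_prod_norm_mul_norm_kernel_le_of_conserving {N : ℕ} (F : Fin N → FreqMomentum L M → ℂ) (hF1 : ∀ ω k, ‖F ω k‖ ≤ 1)
    (G : HubbardGrassmann L M)
    (hfreq : ∀ (m : ℕ) (X : Fin m → HubbardFieldIdx L M),
      (∑ i, (if (X i).2 = 0 then (1 : ℤ) else -1) * matsubaraInt M (X i).1.1.1) ≠ 0 → kernel ℂ G m X = 0)
    (hmom : ∀ (m : ℕ) (X : Fin m → HubbardFieldIdx L M), (∑ i, signedMomentum L (X i).2 (X i).1.1.2) ≠ 0 → kernel ℂ G m X = 0)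
    (m : ℕ) (Ω : Fin (m + 1) → SectorLeg N) {B : ℝ} (hB0 : 0 ≤ B)
    (hker : ∀ k : Fin (m + 1) → FreqMomentum L M, (∀ i, F (Ω i).1.1 (k i) ≠ 0) →
      ‖kernel ℂ G (m + 1) (fun i => ((k i, (Ω i).1.2), (Ω i).2))‖ ≤ B) :
    ∑ k : Fin (m + 1) → FreqMomentum L M, (∏ i, ‖F (Ω i).1.1 (k i)‖) * ‖kernel ℂ G (m + 1) (fun i => ((k i, (Ω i).1.2), (Ω i).2))‖ ≤
      (∏ i : Fin m, ∑ q : FreqMomentum L M, ‖F (Ω i.succ).1.1 q‖) * B := by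
  -- split the tuple as (pinned momentum, free momenta)
  set f : (Fin (m + 1) → FreqMomentum L M) → ℝ := fun k =>
    (∏ i, ‖F (Ω i).1.1 (k i)‖) * ‖kernel ℂ G (m + 1) (fun i => ((k i, (Ω i).1.2), (Ω i).2))‖ with hf
  have hsplit : ∑ k : Fin (m + 1) → FreqMomentum L M, f k =
      ∑ k' : Fin m → FreqMomentum L M, ∑ k₀ : FreqMomentum L M, f (Matrix.vecCons k₀ k') := by
    rw [← (Fin.consEquiv fun _ : Fin (m + 1) => FreqMomentum L M).sum_comp, Fintype.sum_prod_type, sum_comm]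
    rfl
  show ∑ k : Fin (m + 1) → FreqMomentum L M, f k ≤ _
  rw [hsplit]
  -- each free tuple contributes at most `(∏_{i} ‖F_{Ω_{i+1}}(k′_i)‖)·B`
  have hinner : ∀ k' : Fin m → FreqMomentum L M, ∑ k₀ : FreqMomentum L M, f (Matrix.vecCons k₀ k') ≤ (∏ i : Fin m, ‖F (Ω i.succ).1.1 (k' i)‖) * B := by
    intro k'
    have hP0 : 0 ≤ ∏ i : Fin m, ‖F (Ω i.succ).1.1 (k' i)‖ := prod_nonneg fun _ _ => norm_nonneg _
    -- rewrite the summand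
    have hfk : ∀ k₀, f (Matrix.vecCons k₀ k') = (∏ i : Fin m, ‖F (Ω i.succ).1.1 (k' i)‖) *
        (‖F (Ω 0).1.1 k₀‖ * ‖kernel ℂ G (m + 1) (fun i => ((Matrix.vecCons k₀ k' i, (Ω i).1.2), (Ω i).2))‖) := by
      intro k₀
      rw [hf]
      simp only [Fin.prod_univ_succ, Matrix.cons_val_zero, Matrix.cons_val_succ]
      ring
    simp_rw [hfk]
    rw [← mul_sum]
    by_cases hfree : ∀ i : Fin m, F (Ω i.succ).1.1 (k' i) ≠ 0
    · refine mul_le_mul_of_nonneg_left ?_ hP0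
      -- the nonzero terms sit on at most one `k₀`
      set S := (univ : Finset (FreqMomentum L M)).filter fun k₀ =>
        kernel ℂ G (m + 1) (fun i => ((Matrix.vecCons k₀ k' i, (Ω i).1.2), (Ω i).2)) ≠ 0 with hS
      have hcard : S.card ≤ 1 := card_filter_kernel_cons_ne_zero_le_one G hfreq hmom m Ω k'
      have hvan : ∀ k₀ ∈ (univ : Finset (FreqMomentum L M)), k₀ ∉ S →
          ‖F (Ω 0).1.1 k₀‖ * ‖kernel ℂ G (m + 1) (fun i => ((Matrix.vecCons k₀ k' i, (Ω i).1.2), (Ω i).2))‖ = 0 := by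
        intro k₀ _ hk₀
        have : kernel ℂ G (m + 1) (fun i => ((Matrix.vecCons k₀ k' i, (Ω i).1.2), (Ω i).2)) = 0 := by
          by_contra h; exact hk₀ (mem_filter.2 ⟨mem_univ _, h⟩)
        rw [this, norm_zero, mul_zero]
      rw [← sum_subset (subset_univ S) hvan]
      have hterm : ∀ k₀ ∈ S, ‖F (Ω 0).1.1 k₀‖ * ‖kernel ℂ G (m + 1) (fun i => ((Matrix.vecCons k₀ k' i, (Ω i).1.2), (Ω i).2))‖ ≤ B := by
        intro k₀ _
        by_cases h0 : F (Ω 0).1.1 k₀ = 0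
        · rw [h0, norm_zero, zero_mul]; exact hB0
        · have hall : ∀ i : Fin (m + 1), F (Ω i).1.1 (Matrix.vecCons k₀ k' i) ≠ 0 := by
            intro i
            refine Fin.cases ?_ (fun j => ?_) i
            · simpa using h0
            · simpa using hfree j
          calc ‖F (Ω 0).1.1 k₀‖ * ‖kernel ℂ G (m + 1) (fun i => ((Matrix.vecCons k₀ k' i, (Ω i).1.2), (Ω i).2))‖
              ≤ 1 * B := mul_le_mul (hF1 _ _) (hker _ hall) (norm_nonneg _) zero_le_one
            _ = B := one_mul B
      calc ∑ k₀ ∈ S, ‖F (Ω 0).1.1 k₀‖ * ‖kernel ℂ G (m + 1) (fun i => ((Matrix.vecCons k₀ k' i, (Ω i).1.2), (Ω i).2))‖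
          ≤ ∑ _k₀ ∈ S, B := sum_le_sum hterm
        _ = S.card * B := by rw [sum_const, nsmul_eq_mul]
        _ ≤ 1 * B := mul_le_mul_of_nonneg_right (by exact_mod_cast hcard) hB0
        _ = B := one_mul B
    · -- some free leg is off its support: the prefactor vanishes, and so does the left side
      push Not at hfree
      obtain ⟨j, hj⟩ := hfree
      have hP : ∏ i : Fin m, ‖F (Ω i.succ).1.1 (k' i)‖ = 0 := prod_eq_zero (mem_univ j) (by rw [hj, norm_zero])
      rw [hP, zero_mul, zero_mul]
  -- assemble: the free legs' masses factorise
  calc ∑ k' : Fin m → FreqMomentum L M, ∑ k₀ : FreqMomentum L M, f (Matrix.vecCons k₀ k')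
      ≤ ∑ k' : Fin m → FreqMomentum L M, (∏ i : Fin m, ‖F (Ω i.succ).1.1 (k' i)‖) * B := sum_le_sum fun k' _ => hinner k'
    _ = (∑ k' : Fin m → FreqMomentum L M, ∏ i : Fin m, ‖F (Ω i.succ).1.1 (k' i)‖) * B := by rw [sum_mul]
    _ = (∏ i : Fin m, ∑ q : FreqMomentum L M, ‖F (Ω i.succ).1.1 q‖) * B := by
        rw [Fintype.prod_sum (fun (i : Fin m) (q : FreqMomentum L M) => ‖F (Ω i.succ).1.1 q‖)]

/-- **The instance for the scale-`n` action `𝒱_n[K]`** (`[NeZero M]`): both conservation laws are in the tree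
(`kernel_klEffectiveAction_eq_zero_of_freq`, `klEffectiveAction_momentumConserving`). -/
theorem sum_prod_norm_mul_norm_kernel_klEffectiveAction_le [NeZero M] {N : ℕ} (F : Fin N → FreqMomentum L M → ℂ) (hF1 : ∀ ω k, ‖F ω k‖ ≤ 1)
    (β U μ : ℝ) (K : TrigPolyC4v) (e₀ : ℝ) (n : ℕ) (m : ℕ) (Ω : Fin (m + 1) → SectorLeg N) {B : ℝ} (hB0 : 0 ≤ B)
    (hker : ∀ k : Fin (m + 1) → FreqMomentum L M, (∀ i, F (Ω i).1.1 (k i) ≠ 0) →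
      ‖kernel ℂ (klEffectiveAction L M β U μ K e₀ n) (m + 1) (fun i => ((k i, (Ω i).1.2), (Ω i).2))‖ ≤ B) :
    ∑ k : Fin (m + 1) → FreqMomentum L M, (∏ i, ‖F (Ω i).1.1 (k i)‖) *
        ‖kernel ℂ (klEffectiveAction L M β U μ K e₀ n) (m + 1) (fun i => ((k i, (Ω i).1.2), (Ω i).2))‖ ≤
      (∏ i : Fin m, ∑ q : FreqMomentum L M, ‖F (Ω i.succ).1.1 q‖) * B :=
  sum_prod_norm_mul_norm_kernel_le_of_conserving F hF1 _
    (fun _ _ hX => kernel_klEffectiveAction_eq_zero_of_freq β U μ K e₀ n hX)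
    (fun m' X hX => klEffectiveAction_momentumConserving β U μ K e₀ n m' X hX) m Ω hB0 hker

end Summit.HubbardSuperconductivity.HubbardSuperconductivity.Theorems.EngineV8

end
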